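import Summits.ResolutionOfSingularities.ResolutionOfSingularities.Theorems.FrobeniusClosingPatchingRelPerfectMonomialPolyhedraGameMarked
import Summits.ResolutionOfSingularities.ResolutionOfSingularities.Theorems.FrobeniusClosingPatchingRelPerfectMonomialPolyhedraGameGlobal
import HarnessLib

/-!
# Crux `PatchingRelPerfect` (stmt-ResolutionOfSingularities-16161), chain w52 — TargetsF3 (m) «M2-strong»,
# COMBINATORIAL HALF: the FREE GAME and the reduction `GlobalPermissiblePolyhedraGame ↔ FreeGame`

[OURS · L1 W5.2 · background line; res-L1-w52-stub-4 g3 DIRECT-ROUTE-NOTE §1, kernel form; fact-free;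
nothing here is a statement of the manuscript under review]

Hironaka's version of the polyhedra game (file 1, `…MonomialPolyhedraGame.lean`, res-type-075) differs from
Hauser's by the COSUPPORT CONDITION on centres (`Permissible`: every generator has positive weight on the
centre).  This file shows that the condition can be absorbed entirely.  Call a set of indices `F` FREE for a
state `s` (`Free s F`) when every generator is divisible by every divisor indexed by `F` and every stratum
disjoint from `F` is already principal.  Then:

* every non-empty stratum meeting `F` is permissible (`Free.permissible`), and stays so after every move
  (`Free.move`: freeness passes to `move s J e 0` and `insert e F` for ANY permissible `J`; uses
  res-type-075's `principalAt_move_iff`, `…PolyhedraGameGlobal.lean`);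
* a non-principal stratum is always permissible (`permissible_of_not_principalAt`);
* PHASE ONE (`winnable_of_freeGame`): blowing up non-principal `F`-free strata one at a time (their number
  drops at each move: `card_badStrata_move_lt`) turns every well-formed state into a free one, whence
  **`globalPermissiblePolyhedraGame_iff_freeGame`**: the target of file 1 is equivalent to the FREE GAME
  `FreeGame := ∀ s F, s.WF → Free s F → Winnable 0 s` — Hauser's game with centres required to meet the
  exceptional index set, on states whose other strata are principal.

The instance behind R-mono (an `𝔪`-primary monomial ideal: the whole index set is the only permissible
centre) is in the free regime after its forced first move.  No winning strategy for the free game is proved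
here (Route K, res-type-075, is the route of record for the target).

## References

* M. Spivakovsky, *A solution to Hironaka's polyhedra game* (1983), §1 (the cosupport rule). [Spivakovsky1983]
* J. Kollár, *Lectures on Resolution of Singularities* (2007), (3.111) Step 3. [Kollar2007]
-/

-- `Summit.<Summit>.<Sub>.Theorems` with `Sub = Summit` (single-conjunct summit, D-0017)
set_option linter.dupNamespace false

namespace Summit.ResolutionOfSingularities.ResolutionOfSingularities.Theorems

namespace PolyhedraGame

open Finset

/-! ## Free index sets -/

/-- [OURS · W5.2 M2-strong] `F` is FREE for the state `s`: `F` consists of live indices, every generator has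
positive exponent at every index of `F` (the ideal is divisible by every `E_f`, `f ∈ F`), and every stratum
disjoint from `F` is principal. -/
structure Free (s : State) (F : Finset ℕ) : Prop where
  /-- free indices are live -/
  subset : F ⊆ s.B
  /-- every generator involves every free divisor -/
  pos : ∀ α ∈ s.A, ∀ f ∈ F, 1 ≤ α f
  /-- strata away from the free divisors are principal -/
  principalAt : ∀ T ∈ s.Str, Disjoint T F → PrincipalAt s T

/-- [OURS] The empty set is free iff the state is principal. -/
theorem free_empty_iff (s : State) : Free s ∅ ↔ Principal s := by
  constructor
  · exact fun h T hT => h.principalAt T hT (Finset.disjoint_empty_right _)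
  · exact fun h => ⟨Finset.empty_subset _, fun _ _ _ hf => absurd hf (Finset.notMem_empty _),
      fun T hT _ => h T hT⟩

/-- [OURS] **Under freeness every non-empty stratum meeting `F` is permissible** (its weight is at least the
exponent at a free index). -/
theorem Free.permissible {s : State} {F : Finset ℕ} (hF : Free s F) {J : Finset ℕ} (hJ : J ∈ s.Str)
    (hJF : (J ∩ F).Nonempty) : Permissible s J := by
  obtain ⟨f, hf⟩ := hJF
  rw [Finset.mem_inter] at hf
  refine ⟨hJ, ⟨f, hf.1⟩, fun α hα => ?_⟩
  exact (hF.pos α hα f hf.2).trans (Finset.single_le_sum (f := fun j => α j) (fun _ _ => Nat.zero_le _) hf.1)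

/-- [OURS] **A non-principal stratum is permissible**: if some generator had weight `0` on `T` it would
vanish on `T` and be the least restricted exponent. -/
theorem permissible_of_not_principalAt {s : State} (hs : s.WF) {T : Finset ℕ} (hT : T ∈ s.Str)
    (h : ¬ PrincipalAt s T) : Permissible s T := by
  have hTne : T.Nonempty := by
    rw [Finset.nonempty_iff_ne_empty]
    rintro rfl
    obtain ⟨α, hα⟩ := hs.nonempty
    exact h ⟨α, hα, fun _ _ _ hi => absurd hi (Finset.notMem_empty _)⟩
  refine ⟨hT, hTne, fun α hα => ?_⟩
  by_contra hw
  rw [not_le, Nat.lt_one_iff, weight, Finset.sum_eq_zero_iff] at hw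
  exact h ⟨α, hα, fun β _ i hi => by rw [hw i hi]; exact Nat.zero_le _⟩

/-! ## Freeness is preserved by moves -/

/-- [OURS] After a permissible move the new generators involve every old free divisor and the exceptional one
(their exponent at `e` is the weight on the centre). -/
theorem pos_move {s : State} {F J : Finset ℕ} {e : ℕ} (hs : s.WF)
    (hpos : ∀ α ∈ s.A, ∀ f ∈ F, 1 ≤ α f) (hJ : Permissible s J) (he : e ∉ s.B) :
    ∀ β ∈ (move s J e 0).A, ∀ f ∈ insert e F, 1 ≤ β f := by
  intro β hβ f hf
  obtain ⟨α, hα, rfl⟩ := Finset.mem_image.mp hβ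
  by_cases hfe : f = e
  · subst hfe
    have heα : f ∉ α.support := fun h => he (hs.support_subset α hα h)
    rw [moveExp_apply_self α heα, Nat.sub_zero]
    exact hJ.2.2 α hα
  · have hf' : f ∈ F := by
      rcases Finset.mem_insert.mp hf with h | h
      · exact absurd h hfe
      · exact h
    rw [moveExp_apply_of_ne α hfe]
    exact hpos α hα f hf'

/-- [OURS] **Freeness passes to the moved state** (any permissible centre, fresh exceptional index `e`, total
transform): the new generators still involve every old free divisor and involve `E_e` (their exponent at `e`
is the weight on the centre, positive by permissibility), and a stratum of the moved state disjoint from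
`insert e F` is an old stratum disjoint from `F` with the same restricted exponents. -/
theorem Free.move {s : State} {F : Finset ℕ} (hs : s.WF) (hF : Free s F) {J : Finset ℕ} {e : ℕ}
    (hJ : Permissible s J) (he : e ∉ s.B) : Free (move s J e 0) (insert e F) := by
  refine ⟨Finset.insert_subset_insert _ hF.subset, pos_move hs hF.pos hJ he, fun T hT hdisj => ?_⟩
  · have heT : e ∉ T := fun h => Finset.disjoint_left.mp hdisj h (Finset.mem_insert_self _ _)
    have hTold : T ∈ s.Str := (mem_str_of_mem_move_str_of_not_mem hT heT).1
    rw [principalAt_move_iff heT]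
    exact hF.principalAt T hTold (Finset.disjoint_of_subset_right (Finset.subset_insert _ _) hdisj)

/-! ## The free game and phase one -/

/-- [OURS · W5.2 M2-strong] **The FREE GAME** (a `Prop`, NOT proved here): from every well-formed state with a
free index set, finitely many blow-ups of strata (total transform) reach a principal state.  By
`Free.permissible`/`Free.move` every centre meeting the (growing) free set is legal, so this is Hauser's
game with centres required to meet the exceptional set, on states whose other strata are principal. -/
def FreeGame : Prop := ∀ (s : State) (F : Finset ℕ), s.WF → Free s F → Winnable 0 s

/-- [OURS] The strata disjoint from `F` at which the state is not principal. -/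
noncomputable def badStrata (s : State) (F : Finset ℕ) : Finset (Finset ℕ) := by
  classical exact s.Str.filter fun T => Disjoint T F ∧ ¬ PrincipalAt s T

/-- [OURS] Membership in `badStrata`. -/
theorem mem_badStrata_iff {s : State} {F T : Finset ℕ} :
    T ∈ badStrata s F ↔ T ∈ s.Str ∧ Disjoint T F ∧ ¬ PrincipalAt s T := by
  classical
  simp only [badStrata, Finset.mem_filter]

/-- [OURS] A state with no bad strata whose generators involve every free divisor is free. -/
theorem free_of_badStrata_eq_empty {s : State} {F : Finset ℕ} (hFB : F ⊆ s.B)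
    (hpos : ∀ α ∈ s.A, ∀ f ∈ F, 1 ≤ α f) (h : badStrata s F = ∅) : Free s F := by
  refine ⟨hFB, hpos, fun T hT hdisj => ?_⟩
  by_contra hnp
  have : T ∈ badStrata s F := mem_badStrata_iff.mpr ⟨hT, hdisj, hnp⟩
  rw [h] at this
  exact Finset.notMem_empty _ this

/-- [OURS] **Blowing up a bad stratum strictly decreases the number of bad strata**: the bad strata of the
moved state (for `insert e F`) are old bad strata other than the centre. -/
theorem card_badStrata_move_lt {s : State} {F J : Finset ℕ} {e : ℕ} (hJ : J ∈ badStrata s F)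
    (hJB : J ⊆ s.B) (he : e ∉ s.B) : (badStrata (move s J e 0) (insert e F)).card < (badStrata s F).card := by
  refine Finset.card_lt_card ⟨fun T hT => ?_, fun hsub => ?_⟩
  · obtain ⟨hTstr, hdisj, hnp⟩ := mem_badStrata_iff.mp hT
    have heT : e ∉ T := fun h => Finset.disjoint_left.mp hdisj h (Finset.mem_insert_self _ _)
    have hTold : T ∈ s.Str := (mem_str_of_mem_move_str_of_not_mem hTstr heT).1
    refine mem_badStrata_iff.mpr ⟨hTold, Finset.disjoint_of_subset_right (Finset.subset_insert _ _) hdisj,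
      fun hp => hnp ((principalAt_move_iff heT).mpr hp)⟩
  · -- the centre itself is no longer a stratum
    have hJ' := hsub hJ
    obtain ⟨hJstr, -, -⟩ := mem_badStrata_iff.mp hJ'
    rcases mem_moveStrata_iff.mp hJstr with ⟨-, h⟩ | ⟨T₀, -, -, -, hT₀⟩
    · exact h le_rfl
    · have heJ : e ∈ J := hT₀ ▸ Finset.mem_insert_self _ _
      exact he (hJB heJ)

/-- [OURS] **PHASE ONE**: if the free game is won, every well-formed state whose generators involve every
divisor of `F ⊆ B` is winnable — by induction on the number of bad strata, blowing one up at a time (it is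
permissible by `permissible_of_not_principalAt`; the count drops by `card_badStrata_move_lt`; the invariant
«generators involve every free divisor» is kept by `Free.move`'s first half). -/
theorem winnable_of_freeGame (hFG : FreeGame) :
    ∀ (n : ℕ) (s : State) (F : Finset ℕ), s.WF → F ⊆ s.B → (∀ α ∈ s.A, ∀ f ∈ F, 1 ≤ α f) →
      (badStrata s F).card ≤ n → Winnable 0 s := by
  intro n
  induction n with
  | zero =>
    intro s F hs hFB hpos hcard
    exact hFG s F hs (free_of_badStrata_eq_empty hFB hpos (Finset.card_eq_zero.mp (Nat.le_zero.mp hcard)))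
  | succ n ih =>
    intro s F hs hFB hpos hcard
    by_cases h0 : badStrata s F = ∅
    · exact hFG s F hs (free_of_badStrata_eq_empty hFB hpos h0)
    · obtain ⟨J, hJ⟩ := Finset.nonempty_iff_ne_empty.mpr h0
      obtain ⟨hJstr, -, hJnp⟩ := mem_badStrata_iff.mp hJ
      have hperm : Permissible s J := permissible_of_not_principalAt hs hJstr hJnp
      have he : s.B.sup id + 1 ∉ s.B := sup_succ_notMem s
      refine Winnable.step J (s.B.sup id + 1) hperm he
        (ih _ (insert (s.B.sup id + 1) F) (WF.move hs J _ 0) (Finset.insert_subset_insert _ hFB)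
          (pos_move hs hpos hperm he) ?_)
      have := card_badStrata_move_lt hJ (hs.str_subset J hJstr) he
      omega

/-- [OURS] **The cosupport condition is absorbed: `GlobalPermissiblePolyhedraGame ↔ FreeGame`.** -/
theorem globalPermissiblePolyhedraGame_iff_freeGame : GlobalPermissiblePolyhedraGame ↔ FreeGame := by
  constructor
  · exact fun h s F hs _ => h s hs
  · intro hFG s hs
    exact winnable_of_freeGame hFG _ s ∅ hs (Finset.empty_subset _)
      (fun _ _ _ hf => absurd hf (Finset.notMem_empty _)) le_rfl

end PolyhedraGame

end Summit.ResolutionOfSingularities.ResolutionOfSingularities.Theorems
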